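import Summits.ABC.StewartYu.WeightedLatticeBasis
import Mathlib.Analysis.Complex.ExponentialBounds
import HarnessLib

/-!
# Geometry of numbers in a finite-index sublattice of `ℤ^m`, weighted `ℓ¹` form (II): coordinates

Cell topic `Summits/ABC/StewartYu` (cell abc-stewartyu, seat p1); namespace
`Summit.ABC.StewartYu.PrincipalLattice` (theorems only); sequel to `WeightedLatticeBasis.lean`.

* `card_mul_abs_repr_mul_prod_le` — Cramer's rule and Evertse–Győry's Lemma 4.3.6
  (`Dioph.abs_det_le_of_seminorm`, proved in the tree) bound basis coordinates in a lattice basis: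
  `d |cⱼ| ∏ wᵢ ≤ F(x) ∏_{k≠j} F(b_k)`;
* `factorial_sq_mul_le` — the numerical inequality `(m!)² m ≤ 3 (log 2)^m m^{2m}` (induction with
  Bernoulli `2(n+1)^{2n+1} ≤ (n+2)^{2n+1}` and `2 log 2 ≥ 1`), which converts the Cramer bound into the
  interface constant `m^{2m} p (∏ log qᵢ) max|eᵢ|` of `AbcStewartYuPlan.WPM`.

## References

* [EvertseGyory2015] J.-H. Evertse, K. Győry, *Unit Equations in Diophantine Number Theory*,
  CUP 2015 — Lemma 4.3.6 (p. 72).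
-/

noncomputable section

namespace Summit.ABC.StewartYu.PrincipalLattice

open MeasureTheory Module Finset
open Literature.NumberTheory.DiophantineGeometry.Dioph

/-- **Cramer's bound for basis coordinates, weighted form.** Let `b` be a `ℤ`-basis of
`L ≤ ℤ^m` (`m ≥ 1`, index `d`), `wᵢ > 0`, `F(x) = ∑ wᵢ|xᵢ|`, and `x ∈ L` with coordinates
`c = b.repr x`. Then for every `j`: `d · |cⱼ| · ∏ᵢ wᵢ ≤ F(x) · ∏_{k ≠ j} F(b_k)` — Cramer's rule
`det(b) · cⱼ = det(b with bⱼ ← x)`, `|det(b)| = d`, and Evertse–Győry's Lemma 4.3.6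
(`Dioph.abs_det_le_of_seminorm`: `|det| ≤ (m!/2^m) · vol{F ≤ 1} · ∏ F(rows)`, PROVED in the
tree) with `vol{F ≤ 1} = 2^m/(m! ∏ wᵢ)`. [folklore] -/
theorem card_mul_abs_repr_mul_prod_le {m : ℕ} (hm : 0 < m) (L : Submodule ℤ (Fin m → ℤ))
    [Finite ((Fin m → ℤ) ⧸ L)] (b : Module.Basis (Fin m) ℤ L) (w : Fin m → ℝ)
    (hw : ∀ i, 0 < w i) (x : L) (j : Fin m) :
    (Nat.card ((Fin m → ℤ) ⧸ L) : ℝ) * |(b.repr x j : ℝ)| * ∏ i, w i ≤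
      (∑ i, w i * |((x : Fin m → ℤ) i : ℝ)|) *
        ∏ k ∈ Finset.univ.erase j, (∑ i, w i * |(((b k : L) : Fin m → ℤ) i : ℝ)|) := by
  classical
  -- the matrix of the basis (rows) and its determinant
  set R : Matrix (Fin m) (Fin m) ℤ := Matrix.of fun k i => ((b k : L) : Fin m → ℤ) i with hR
  have hdet : R.det.natAbs = Nat.card ((Fin m → ℤ) ⧸ L) := by
    have h := Submodule.natAbs_det_basis_change (Pi.basisFun ℤ (Fin m)) L b
    rw [Module.Basis.det_apply] at h
    rw [← h, ← Matrix.det_transpose]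
    congr 2
  -- coordinates: `x = Rᵀ c`
  set c : Fin m → ℤ := fun k => b.repr x k with hc
  have hx : (x : Fin m → ℤ) = R.transpose.mulVec c := by
    have h1 : (x : L) = ∑ k, c k • b k := by
      rw [hc]; exact (b.sum_repr x).symm
    have h2 : ((x : L) : Fin m → ℤ) = ∑ k, c k • ((b k : L) : Fin m → ℤ) := by
      rw [h1, Submodule.coe_sum]; rfl
    rw [h2]
    ext i
    simp [Matrix.mulVec, dotProduct, hR, Finset.sum_apply, mul_comm]
  -- Cramer: `det R · c_j = det (R with row j ← x)`
  have hcramer : R.det * c j = (R.updateRow j (x : Fin m → ℤ)).det := by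
    have h1 : Matrix.cramer R.transpose (x : Fin m → ℤ) = R.transpose.det • c := by
      rw [hx, Matrix.cramer_eq_adjugate_mulVec, Matrix.mulVec_mulVec, Matrix.adjugate_mul,
        Matrix.smul_mulVec, Matrix.one_mulVec]
    have h2 := congrFun h1 j
    rw [Matrix.cramer_transpose_apply, Pi.smul_apply, smul_eq_mul, Matrix.det_transpose] at h2
    exact h2.symm
  -- the real matrix of rows `b_k (k ≠ j), x`
  let f : Fin m → Fin m → ℝ := fun k i => ((R.updateRow j (x : Fin m → ℤ)) k i : ℝ)
  have hdetf : (((R.updateRow j (x : Fin m → ℤ)).det : ℤ) : ℝ) = (Matrix.of f).det := by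
    rw [show (((R.updateRow j (x : Fin m → ℤ)).det : ℤ) : ℝ) =
        (Int.castRingHom ℝ) (R.updateRow j (x : Fin m → ℤ)).det from rfl, RingHom.map_det]
    congr 1
  -- Lemma 4.3.6 for the weighted norm
  obtain ⟨F, hF, hF0⟩ := exists_seminorm_weighted w hw
  have h436 := abs_det_le_of_seminorm hm F hF0 f
  have hΩ : 0 < ∏ i, w i := Finset.prod_pos fun i _ => hw i
  have hvol : (volume {z : Fin m → ℝ | F z ≤ 1}).toReal = 2 ^ m / (m.factorial * ∏ i, w i) := by
    simp only [hF]
    rw [volume_weighted_le_one hm w hw,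
      ENNReal.toReal_ofReal (div_nonneg (by positivity) (mul_nonneg (by positivity) hΩ.le))]
  rw [hvol] at h436
  have hfac : (0 : ℝ) < m.factorial := by exact_mod_cast Nat.factorial_pos m
  have hconst : (m.factorial : ℝ) / 2 ^ m * (2 ^ m / (m.factorial * ∏ i, w i)) = (∏ i, w i)⁻¹ := by
    field_simp
  rw [hconst] at h436
  -- the rows
  have hrows : ∏ k, F (f k) = (∑ i, w i * |((x : Fin m → ℤ) i : ℝ)|) *
      ∏ k ∈ Finset.univ.erase j, (∑ i, w i * |(((b k : L) : Fin m → ℤ) i : ℝ)|) := by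
    rw [← Finset.mul_prod_erase Finset.univ _ (Finset.mem_univ j)]
    congr 1
    · rw [hF]
      refine Finset.sum_congr rfl fun i _ => ?_
      simp [f, Matrix.updateRow_self]
    · refine Finset.prod_congr rfl fun k hk => ?_
      rw [hF]
      refine Finset.sum_congr rfl fun i _ => ?_
      simp [f, Matrix.updateRow_ne (Finset.ne_of_mem_erase hk), hR]
  rw [hrows] at h436
  -- assemble
  have hlhs : (Nat.card ((Fin m → ℤ) ⧸ L) : ℝ) * |(b.repr x j : ℝ)| = |(Matrix.of f).det| := by
    rw [← hdetf, ← hcramer, ← hdet, Nat.cast_natAbs, Int.cast_abs]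
    push_cast
    rw [abs_mul]
  rw [hlhs]
  calc |(Matrix.of f).det| * ∏ i, w i
      ≤ (∏ i, w i)⁻¹ * ((∑ i, w i * |((x : Fin m → ℤ) i : ℝ)|) *
          ∏ k ∈ Finset.univ.erase j, (∑ i, w i * |(((b k : L) : Fin m → ℤ) i : ℝ)|)) *
          ∏ i, w i := mul_le_mul_of_nonneg_right h436 hΩ.le
    _ = _ := by field_simp


/-! ### A numerical inequality: `(m!)² · m ≤ 3 (log 2)^m · m^{2m}` -/

/-- Bernoulli: `2 (n+1)^{2n+1} ≤ (n+2)^{2n+1}`. [folklore] -/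
theorem two_mul_pow_le_pow (n : ℕ) :
    (2 : ℝ) * ((n : ℝ) + 1) ^ (2 * n + 1) ≤ ((n : ℝ) + 2) ^ (2 * n + 1) := by
  have hn1 : (0 : ℝ) < (n : ℝ) + 1 := by positivity
  have hx : (0 : ℝ) ≤ 1 / ((n : ℝ) + 1) := by positivity
  have hB := one_add_mul_le_pow (show (-2 : ℝ) ≤ 1 / ((n : ℝ) + 1) by linarith) (2 * n + 1)
  have h2 : (2 : ℝ) ≤ 1 + ((2 * n + 1 : ℕ) : ℝ) * (1 / ((n : ℝ) + 1)) := by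
    rw [mul_one_div]
    have : (1 : ℝ) ≤ ((2 * n + 1 : ℕ) : ℝ) / ((n : ℝ) + 1) := by
      rw [le_div_iff₀ hn1]; push_cast; linarith
    linarith
  have h3 : ((n : ℝ) + 2) ^ (2 * n + 1) =
      ((n : ℝ) + 1) ^ (2 * n + 1) * (1 + 1 / ((n : ℝ) + 1)) ^ (2 * n + 1) := by
    rw [← mul_pow]; congr 1; field_simp; ring
  rw [h3]
  calc (2 : ℝ) * ((n : ℝ) + 1) ^ (2 * n + 1) = ((n : ℝ) + 1) ^ (2 * n + 1) * 2 := mul_comm _ _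
    _ ≤ ((n : ℝ) + 1) ^ (2 * n + 1) * (1 + ((2 * n + 1 : ℕ) : ℝ) * (1 / ((n : ℝ) + 1))) :=
        mul_le_mul_of_nonneg_left h2 (by positivity)
    _ ≤ ((n : ℝ) + 1) ^ (2 * n + 1) * (1 + 1 / ((n : ℝ) + 1)) ^ (2 * n + 1) :=
        mul_le_mul_of_nonneg_left hB (by positivity)

/-- `((n+1)!)² (n+1) ≤ 3 (log 2)^{n+1} (n+1)^{2(n+1)}` (induction; the step is
`2 (n+1)^{2n+1} ≤ (n+2)^{2n+1}` and `2 log 2 ≥ 1`). [folklore] -/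
theorem factorial_sq_mul_le_aux (n : ℕ) :
    ((n + 1).factorial : ℝ) ^ 2 * ((n : ℝ) + 1) ≤
      3 * Real.log 2 ^ (n + 1) * ((n : ℝ) + 1) ^ (2 * (n + 1)) := by
  have hL : (0.6931471803 : ℝ) < Real.log 2 := Real.log_two_gt_d9
  have hL0 : 0 < Real.log 2 := by linarith
  induction n with
  | zero => simp only [zero_add, Nat.factorial_one, Nat.cast_one, one_pow, pow_one,
      CharP.cast_eq_zero, mul_one]; linarith
  | succ n ih =>
    set A : ℝ := (n : ℝ) + 1 with hA
    set B : ℝ := (n : ℝ) + 2 with hB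
    set f : ℝ := ((n + 1).factorial : ℝ) with hf
    set P : ℝ := A ^ (2 * n + 1) with hP
    set Q : ℝ := B ^ (2 * n + 1) with hQ
    have hA0 : 0 < A := by positivity
    have hB0 : 0 < B := by positivity
    have key : 2 * P ≤ Q := two_mul_pow_le_pow n
    -- the induction hypothesis: `f² ≤ 3 L^{n+1} P`
    have hih : f ^ 2 ≤ 3 * Real.log 2 ^ (n + 1) * P := by
      have h1 : ((n : ℝ) + 1) ^ (2 * (n + 1)) = P * A := by
        rw [hP, hA, show 2 * (n + 1) = (2 * n + 1) + 1 by ring, pow_succ]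
      rw [h1] at ih
      have h2 : f ^ 2 * A ≤ (3 * Real.log 2 ^ (n + 1) * P) * A := by rw [hf, hA]; linarith
      exact le_of_mul_le_mul_right h2 hA0
    -- rewrite the goal
    have hfac : ((n + 1 + 1).factorial : ℝ) = B * f := by
      rw [Nat.factorial_succ, hB, hf]; push_cast; ring
    have hcast : ((n + 1 : ℕ) : ℝ) + 1 = B := by rw [hB]; push_cast; ring
    have hpow : B ^ (2 * (n + 1 + 1)) = Q * B ^ 3 := by
      rw [hQ, show 2 * (n + 1 + 1) = (2 * n + 1) + 3 by ring, pow_add]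
    rw [hfac, hcast, hpow]
    have hL2 : P ≤ Real.log 2 * Q := by
      have hQ0 : 0 ≤ Q := by positivity
      have : 0 ≤ (Real.log 2 - 1 / 2) * Q := mul_nonneg (by linarith) hQ0
      linarith
    calc (B * f) ^ 2 * B = B ^ 3 * f ^ 2 := by ring
      _ ≤ B ^ 3 * (3 * Real.log 2 ^ (n + 1) * P) :=
          mul_le_mul_of_nonneg_left hih (by positivity)
      _ ≤ B ^ 3 * (3 * Real.log 2 ^ (n + 1) * (Real.log 2 * Q)) := by gcongr
      _ = 3 * Real.log 2 ^ (n + 1 + 1) * (Q * B ^ 3) := by ring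

/-- **`(m!)² · m ≤ 3 · (log 2)^m · m^{2m}`** for every `m ∈ ℕ`. [folklore] -/
theorem factorial_sq_mul_le (m : ℕ) :
    (m.factorial : ℝ) ^ 2 * m ≤ 3 * Real.log 2 ^ m * (m : ℝ) ^ (2 * m) := by
  rcases m with _ | n
  · simp
  · have := factorial_sq_mul_le_aux n
    push_cast
    exact this

end Summit.ABC.StewartYu.PrincipalLattice

end
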